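import Literature.NumberTheory.Rogawski1990.AdelicStableOrbitalSumFactor
import Literature.NumberTheory.Rogawski1990.AdelicStableOrbitalEulerLocal
import Literature.NumberTheory.Automorphic.UnitaryGroupOrbitalMeasureFamilyOfLocalAdelic
import Literature.NumberTheory.Automorphic.UnramifiedOrbitSetHermitian
import HarnessLib

/-!
# The (xii-d) discharge: `IsEulerOnClasses 𝒞_𝐀(γ₀) (ofLocalAdelic mq mqi) T.eval S (v ↦ Φ^st_v) Φ^st_∞` for the quasi-split `G = U(Φ₃)` and every
# `IsTest` pure tensor — modulo the normalisation of the local families at the matching adèles and the integrability of the orbital integrands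
(Rogawski (1990), §4.3 p. 44 «we may therefore set `Φ^κ(γ, f) = Π_v Φ^{κ_v}(γ, f_v)` … the sum is finite»; §5.4 (5.4.3) pp. 72–73: `Φ^{st,𝐀}(γ, f) =
Σ_{δ ∈ 𝒞_𝐀} Φ(δ, f)`; Kottwitz (1986) Prop. 7.1, §7.3)

Topic `NumberTheory/Rogawski1990`; namespace `Literature.NumberTheory.Rogawski1990`.  THEOREMS ONLY: no definition, no named fact, no instance, no `sorry`.
Cell `pub/hodgecm-mathlib`, ENGINE T1, ED 1.19c (xii-d) ∕ O11 — the G-side adelic stable orbital integral of the kit's measure data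
`m𝐀 := ofLocalAdelic 𝔨.mq 𝔨.mqi` (★ Q4-C3) on an `IsTest` pure tensor `T` IS the Euler product of the LOCAL STABLE orbital integrals at the rational
correspondent `γ ∈ U(Φ₃)(L⁺)` of `γ₀`, times the archimedean one — ★ typ3's relation `IsEulerOnClasses`, PROVED.  Assembly of ★ (E3a)
`MatchingAdeleG.isEulerOnClasses_of_factor` with: (fac) ★ C3 `classOrbitalIntegral_ofLocalAdelic_eval_eq_mul_prod` at every class (its unit factors off
`S₂(c) := S₁ ∪ {places where the local class of c is not ⟦γ_v⟧}` by ★ (E2) `eventually_map_toLocal_eq_mk` and the base-class unit factor), (h1) ★ (S)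
`eventually_classOrbitalIntegral_indicator_eq_one` at `γ` with ★ `unramifiedOrbitSetAE_of_hermitian` (fact-free), (h0) ★ (E3b-loc)
`classOrbitalIntegral_indicator_eq_zero_of_corresponds_of_ne`, (hfin) ★ (E3b-loc).  HYPOTHESES kept honest and named: the [Kt₄]-7.1 fact
★ `MatchingAdeleGEventuallyKConj L H` (its discharge is in flight, p03∕p02); admissibility of `mq v`, `mqi` on the regular classes; NORMALISATION of `mq` at
`toAdelic γ` and at every matching adèle (for canonical `mq`: ★ `exists_isNormalisedOff_of_isCanonical` ∕ ★ `exists_isNormalisedOff_matchingAdeleG`); and the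
INTEGRABILITY of the orbital integrand of `T.eval` at every class of `𝒞_𝐀(γ₀)` for `ofLocalAdelic mq mqi` (for the anisotropic inner form this is ★
`integrable_descConj_toAdelic_out_of_admissibleAt`; for the quasi-split `U(Φ₃)` at REGULAR adelic classes it is the closed-orbit statement of
[Rogawski1990, §4.9] ∕ [GetzHahn2024, Thm. 17.4.1], not yet in the tree — the one analytic input this file does not discharge).
HC_CM is proved only modulo the printed citations until rung 0 closes; this file is unconditional modulo its stated hypotheses.

## References
* [Rogawski1990] J. D. Rogawski, *Automorphic Representations of Unitary Groups in Three Variables*, Ann. of Math. Stud. 123 (1990), §4.3 p. 44, §4.9 p. 54,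
  §5.4 (5.4.3) pp. 72–73.
* [Kottwitz1986] R. E. Kottwitz, *Stable trace formula: elliptic singular terms*, Math. Ann. 275 (1986), Prop. 7.1, §7.3.
* [GetzHahn2024] J. R. Getz, H. Hahn, *An Introduction to Automorphic Representations*, GTM 300 (2024), Thm. 17.4.1.
-/

noncomputable section

open NumberField IsDedekindDomain Filter Function MeasureTheory
open scoped MatrixGroups

namespace Literature.NumberTheory.Rogawski1990

open Literature.NumberTheory.Automorphic Literature.MeasureTheory.Group
open Literature.AlgebraicGeometry.ShimuraVarieties (hermForm)

section Discharge

variable {L : Type} [Field L] [NumberField L] [IsCMField L] {H : Matrix (Fin 3) (Fin 3) L}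
  {γ₀ : (UnitaryGroup.cmDatum L 3 H).Rational}
  {γ : (UnitaryGroup.cmDatum L 3 (Matrix.of fun i j : Fin 3 => if i.val + j.val + 1 = 3 then (1 : L) else 0)).Rational}
  [∀ g : (UnitaryGroup.cmDatum L 3 (Matrix.of fun i j : Fin 3 => if i.val + j.val + 1 = 3 then (1 : L) else 0)).Adelic,
    MeasurableSpace ((UnitaryGroup.cmDatum L 3 (Matrix.of fun i j : Fin 3 => if i.val + j.val + 1 = 3 then (1 : L) else 0)).Adelic ⧸
      Subgroup.centralizer ({g} : Set (UnitaryGroup.cmDatum L 3 (Matrix.of fun i j : Fin 3 => if i.val + j.val + 1 = 3 then (1 : L) else 0)).Adelic))]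
  [∀ g : (UnitaryGroup.cmDatum L 3 (Matrix.of fun i j : Fin 3 => if i.val + j.val + 1 = 3 then (1 : L) else 0)).Adelic,
    BorelSpace ((UnitaryGroup.cmDatum L 3 (Matrix.of fun i j : Fin 3 => if i.val + j.val + 1 = 3 then (1 : L) else 0)).Adelic ⧸
      Subgroup.centralizer ({g} : Set (UnitaryGroup.cmDatum L 3 (Matrix.of fun i j : Fin 3 => if i.val + j.val + 1 = 3 then (1 : L) else 0)).Adelic))]
  [∀ (v : HeightOneSpectrum (𝓞 ↥(maximalRealSubfield L)))
    (x : (UnitaryGroup.cmDatum L 3 (Matrix.of fun i j : Fin 3 => if i.val + j.val + 1 = 3 then (1 : L) else 0)).Local v),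
    MeasurableSpace ((UnitaryGroup.cmDatum L 3 (Matrix.of fun i j : Fin 3 => if i.val + j.val + 1 = 3 then (1 : L) else 0)).Local v ⧸
      Subgroup.centralizer ({x} : Set ((UnitaryGroup.cmDatum L 3 (Matrix.of fun i j : Fin 3 => if i.val + j.val + 1 = 3 then (1 : L) else 0)).Local v)))]
  [∀ (v : HeightOneSpectrum (𝓞 ↥(maximalRealSubfield L)))
    (x : (UnitaryGroup.cmDatum L 3 (Matrix.of fun i j : Fin 3 => if i.val + j.val + 1 = 3 then (1 : L) else 0)).Local v),
    BorelSpace ((UnitaryGroup.cmDatum L 3 (Matrix.of fun i j : Fin 3 => if i.val + j.val + 1 = 3 then (1 : L) else 0)).Local v ⧸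
      Subgroup.centralizer ({x} : Set ((UnitaryGroup.cmDatum L 3 (Matrix.of fun i j : Fin 3 => if i.val + j.val + 1 = 3 then (1 : L) else 0)).Local v)))]
  [∀ a : UnitaryGroup.arch (↥(maximalRealSubfield L)) L (IsCMField.complexConj L) 3 (Matrix.of fun i j : Fin 3 => if i.val + j.val + 1 = 3 then (1 : L) else 0),
    MeasurableSpace (UnitaryGroup.arch (↥(maximalRealSubfield L)) L (IsCMField.complexConj L) 3 (Matrix.of fun i j : Fin 3 => if i.val + j.val + 1 = 3 then (1 : L) else 0) ⧸
      Subgroup.centralizer ({a} : Set (UnitaryGroup.arch (↥(maximalRealSubfield L)) L (IsCMField.complexConj L) 3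
        (Matrix.of fun i j : Fin 3 => if i.val + j.val + 1 = 3 then (1 : L) else 0))))]
  [∀ a : UnitaryGroup.arch (↥(maximalRealSubfield L)) L (IsCMField.complexConj L) 3 (Matrix.of fun i j : Fin 3 => if i.val + j.val + 1 = 3 then (1 : L) else 0),
    BorelSpace (UnitaryGroup.arch (↥(maximalRealSubfield L)) L (IsCMField.complexConj L) 3 (Matrix.of fun i j : Fin 3 => if i.val + j.val + 1 = 3 then (1 : L) else 0) ⧸
      Subgroup.centralizer ({a} : Set (UnitaryGroup.arch (↥(maximalRealSubfield L)) L (IsCMField.complexConj L) 3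
        (Matrix.of fun i j : Fin 3 => if i.val + j.val + 1 = 3 then (1 : L) else 0))))]

/-- **THE (xii-d) DISCHARGE.**  `G = U(Φ₃)`, `γ₀ ∈ U(H)(L⁺)` regular with rational correspondent `γ ∈ U(Φ₃)(L⁺)`, ★ `MatchingAdeleGEventuallyKConj L H`; local families
`mq v` and an archimedean family `mqi` ADMISSIBLE on the regular classes; `mq` NORMALISED off a finite set at `toAdelic γ` and at EVERY matching adèle; an
`IsTest` pure tensor `T` whose orbital integrand is integrable at every class of `𝒞_𝐀(γ₀)` for `ofLocalAdelic mq mqi`.  THEN there is a finite `S₁` such that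
for every finite `S ⊇ S₁`:
`IsEulerOnClasses (MatchingAdeleG.classes L H γ₀) (ofLocalAdelic mq mqi) T.eval S (v ↦ Φ^st_v(γ_v, T.loc v; mq v)) (Φ^st_∞(γ ⊗ 1, T.arch; mqi))`
— `Σ_{δ ∈ 𝒞_𝐀(γ₀)} Φ(δ, T.eval) = Φ^st_∞ · ∏_{v ∈ S} Φ^st_v`. [cite: Rogawski1990, §4.3 p. 44; §5.4 (5.4.3) pp. 72–73] [cite: Kottwitz1986, Prop. 7.1] -/
theorem MatchingAdeleG.exists_isEulerOnClasses_ofLocalAdelic (hKC : MatchingAdeleGEventuallyKConj L H)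
    (hreg : IsRegularElt (γ₀.val : GL (Fin 3) L))
    (hγ : Corresponds (cmConjRingHom L) H (Matrix.of fun i j : Fin 3 => if i.val + j.val + 1 = 3 then (1 : L) else 0) γ₀ γ)
    (mq : ∀ v : HeightOneSpectrum (𝓞 ↥(maximalRealSubfield L)),
      OrbitalMeasureFamily ((UnitaryGroup.cmDatum L 3 (Matrix.of fun i j : Fin 3 => if i.val + j.val + 1 = 3 then (1 : L) else 0)).Local v))
    (mqi : OrbitalMeasureFamily (UnitaryGroup.arch (↥(maximalRealSubfield L)) L (IsCMField.complexConj L) 3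
      (Matrix.of fun i j : Fin 3 => if i.val + j.val + 1 = 3 then (1 : L) else 0)))
    (hadm : ∀ v, (mq v).IsAdmissibleOn fun x => IsRegularElt (x.val : GL (Fin 3) (UnitaryGroup.LocalRing L v)))
    (hadmA : mqi.IsAdmissibleOn fun a => IsRegularElt (a.val : GL (Fin 3) (mixedEmbedding.mixedSpace L)))
    (hnormγ : ∃ S₀ : Finset (HeightOneSpectrum (𝓞 ↥(maximalRealSubfield L))),
      UnitaryGroup.IsNormalisedOff L 3 (Matrix.of fun i j : Fin 3 => if i.val + j.val + 1 = 3 then (1 : L) else 0) mq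
        ((UnitaryGroup.cmDatum L 3 (Matrix.of fun i j : Fin 3 => if i.val + j.val + 1 = 3 then (1 : L) else 0)).toAdelic γ) S₀)
    (hnorm : ∀ p : MatchingAdeleG L H γ₀, ∃ S₀ : Finset (HeightOneSpectrum (𝓞 ↥(maximalRealSubfield L))),
      UnitaryGroup.IsNormalisedOff L 3 (Matrix.of fun i j : Fin 3 => if i.val + j.val + 1 = 3 then (1 : L) else 0) mq p.adele S₀)
    (T : UnitaryGroup.PureTensor L 3 (Matrix.of fun i j : Fin 3 => if i.val + j.val + 1 = 3 then (1 : L) else 0)) (hT : T.IsTest)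
    (hFi : ∀ c ∈ MatchingAdeleG.classes L H γ₀, Integrable
      (descConj (Quotient.out c : (UnitaryGroup.cmDatum L 3 (Matrix.of fun i j : Fin 3 => if i.val + j.val + 1 = 3 then (1 : L) else 0)).Adelic)
        (Subgroup.centralizer ({(Quotient.out c : (UnitaryGroup.cmDatum L 3 (Matrix.of fun i j : Fin 3 => if i.val + j.val + 1 = 3 then (1 : L) else 0)).Adelic)} :
          Set (UnitaryGroup.cmDatum L 3 (Matrix.of fun i j : Fin 3 => if i.val + j.val + 1 = 3 then (1 : L) else 0)).Adelic))
        (centralizer_comm _) T.eval)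
      (UnitaryGroup.OrbitalMeasureFamily.ofLocalAdelic L 3 (Matrix.of fun i j : Fin 3 => if i.val + j.val + 1 = 3 then (1 : L) else 0) mq mqi c)) :
    ∃ S₁ : Finset (HeightOneSpectrum (𝓞 ↥(maximalRealSubfield L))), ∀ S : Finset (HeightOneSpectrum (𝓞 ↥(maximalRealSubfield L))), S₁ ⊆ S →
      IsEulerOnClasses (MatchingAdeleG.classes L H γ₀)
        (UnitaryGroup.OrbitalMeasureFamily.ofLocalAdelic L 3 (Matrix.of fun i j : Fin 3 => if i.val + j.val + 1 = 3 then (1 : L) else 0) mq mqi) T.eval S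
        (fun v => localStableOrbitalIntegral L 3 (Matrix.of fun i j : Fin 3 => if i.val + j.val + 1 = 3 then (1 : L) else 0) v (mq v) (T.loc v)
          ((UnitaryGroup.cmDatum L 3 (Matrix.of fun i j : Fin 3 => if i.val + j.val + 1 = 3 then (1 : L) else 0)).toLocal v
            ((UnitaryGroup.cmDatum L 3 (Matrix.of fun i j : Fin 3 => if i.val + j.val + 1 = 3 then (1 : L) else 0)).toAdelic γ)))
        (archStableOrbitalIntegral L 3 (Matrix.of fun i j : Fin 3 => if i.val + j.val + 1 = 3 then (1 : L) else 0) mqi T.arch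
          (cmRationalToArch L 3 (Matrix.of fun i j : Fin 3 => if i.val + j.val + 1 = 3 then (1 : L) else 0) γ)) := by
  classical
  -- abbreviations for the regularity of `γ` and of its components
  have hγreg : IsRegularElt (γ.val : GL (Fin 3) L) := isRegularElt_of_isConj hγ hreg
  have hγv : ∀ v : HeightOneSpectrum (𝓞 ↥(maximalRealSubfield L)),
      IsRegularElt (((UnitaryGroup.cmDatum L 3 (Matrix.of fun i j : Fin 3 => if i.val + j.val + 1 = 3 then (1 : L) else 0)).toLocal v
        ((UnitaryGroup.cmDatum L 3 (Matrix.of fun i j : Fin 3 => if i.val + j.val + 1 = 3 then (1 : L) else 0)).toAdelic γ)).val :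
          GL (Fin 3) (UnitaryGroup.LocalRing L v)) := fun v =>
    (hγreg.map (algebraMap L (AdeleRing (𝓞 L) L))).map (UnitaryGroup.adeleToLocal L v)
  -- regularity of anything corresponding to `(γ₀)_v`, and of class representatives
  have hregcorr : ∀ v (x : (UnitaryGroup.cmDatum L 3 (Matrix.of fun i j : Fin 3 => if i.val + j.val + 1 = 3 then (1 : L) else 0)).Local v),
      Corresponds (UnitaryGroup.conjLocal L (IsCMField.complexConj L) v)
        ((UnitaryGroup.adelicForm L 3 H).map (UnitaryGroup.adeleToLocal L v))
        ((UnitaryGroup.adelicForm L 3 (Matrix.of fun i j : Fin 3 => if i.val + j.val + 1 = 3 then (1 : L) else 0)).map (UnitaryGroup.adeleToLocal L v))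
        ((UnitaryGroup.cmDatum L 3 H).toLocal v ((UnitaryGroup.cmDatum L 3 H).toAdelic γ₀)) x →
      IsRegularElt (x.val : GL (Fin 3) (UnitaryGroup.LocalRing L v)) := fun v x hx =>
    isRegularElt_of_isConj ((corresponds_toLocal_toAdelic hγ v).isStablyConj_right hx) (hγv v)
  have hregout : ∀ v (x : (UnitaryGroup.cmDatum L 3 (Matrix.of fun i j : Fin 3 => if i.val + j.val + 1 = 3 then (1 : L) else 0)).Local v),
      IsRegularElt (x.val : GL (Fin 3) (UnitaryGroup.LocalRing L v)) →
      IsRegularElt ((Quotient.out (ConjClasses.mk x) :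
        (UnitaryGroup.cmDatum L 3 (Matrix.of fun i j : Fin 3 => if i.val + j.val + 1 = 3 then (1 : L) else 0)).Local v).val :
          GL (Fin 3) (UnitaryGroup.LocalRing L v)) := fun v x hx =>
    isRegularElt_of_isConj ((UnitaryGroup.«local» L (IsCMField.complexConj L) 3
      (Matrix.of fun i j : Fin 3 => if i.val + j.val + 1 = 3 then (1 : L) else 0) v).subtype.map_isConj (isConj_out_conjClasses_mk x)) hx
  -- admissibility triples at a regular local point
  have hadmAt : ∀ v (x : (UnitaryGroup.cmDatum L 3 (Matrix.of fun i j : Fin 3 => if i.val + j.val + 1 = 3 then (1 : L) else 0)).Local v),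
      IsRegularElt (x.val : GL (Fin 3) (UnitaryGroup.LocalRing L v)) →
      mq v (ConjClasses.mk x) ≠ 0 ∧ SMulInvariantMeasure _ _ (mq v (ConjClasses.mk x)) ∧ IsFiniteMeasureOnCompacts (mq v (ConjClasses.mk x)) :=
    fun v x hx => hadm v (ConjClasses.mk x) (hregout v x hx)
  -- (1) the [Kt₄]-7.1 places
  have hKCev := hKC γ₀ γ hreg hγ
  have hKfin := Filter.eventually_cofinite.1 hKCev
  -- (2) the unit-factor places at the base class `[γ_v]` (★ (S), fact-free at hermitian non-degenerate `Φ₃`)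
  obtain ⟨S₀γ, hS₀γ⟩ := hnormγ
  have hunit := UnitaryGroup.eventually_classOrbitalIntegral_indicator_eq_one L 3
    (Matrix.of fun i j : Fin 3 => if i.val + j.val + 1 = 3 then (1 : L) else 0) mq
    (UnitaryGroup.unramifiedOrbitSetAE_of_hermitian L 3 (Matrix.of fun i j : Fin 3 => if i.val + j.val + 1 = 3 then (1 : L) else 0)
      (UnitaryGroup.antidiagOne_isHermitian L 3) (UnitaryGroup.isUnit_antidiagOne_det L 3).ne_zero)
    γ hγreg (fun v => (hadmAt v _ (hγv v)).2.1) hS₀γ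
  have hUfin := Filter.eventually_cofinite.1 hunit
  refine ⟨T.S ∪ hKfin.toFinset ∪ hUfin.toFinset, fun S hS => ?_⟩
  have hS_T : ∀ v ∉ S, v ∉ T.S := fun v hv h => hv (hS (Finset.mem_union_left _ (Finset.mem_union_left _ h)))
  have hS_K : ∀ v ∉ S, ∀ g : (UnitaryGroup.cmDatum L 3 (Matrix.of fun i j : Fin 3 => if i.val + j.val + 1 = 3 then (1 : L) else 0)).Local v,
      g ∈ UnitaryGroup.cmLocalIntegralLevel L 3 (Matrix.of fun i j : Fin 3 => if i.val + j.val + 1 = 3 then (1 : L) else 0) v →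
      Corresponds (UnitaryGroup.conjLocal L (IsCMField.complexConj L) v)
          ((UnitaryGroup.adelicForm L 3 H).map (UnitaryGroup.adeleToLocal L v))
          ((UnitaryGroup.adelicForm L 3 (Matrix.of fun i j : Fin 3 => if i.val + j.val + 1 = 3 then (1 : L) else 0)).map (UnitaryGroup.adeleToLocal L v))
          ((UnitaryGroup.cmDatum L 3 H).toLocal v ((UnitaryGroup.cmDatum L 3 H).toAdelic γ₀)) g →
        ∃ k ∈ UnitaryGroup.cmLocalIntegralLevel L 3 (Matrix.of fun i j : Fin 3 => if i.val + j.val + 1 = 3 then (1 : L) else 0) v,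
          k * (UnitaryGroup.cmDatum L 3 (Matrix.of fun i j : Fin 3 => if i.val + j.val + 1 = 3 then (1 : L) else 0)).toLocal v
                ((UnitaryGroup.cmDatum L 3 (Matrix.of fun i j : Fin 3 => if i.val + j.val + 1 = 3 then (1 : L) else 0)).toAdelic γ) * k⁻¹ = g := by
    intro v hv
    by_contra hnot
    exact hv (hS (Finset.mem_union_left _ (Finset.mem_union_right _ (hKfin.mem_toFinset.2 hnot))))
  have hS_U : ∀ v ∉ S, classOrbitalIntegral (mq v)
      ((UnitaryGroup.cmLocalIntegralLevel L 3 (Matrix.of fun i j : Fin 3 => if i.val + j.val + 1 = 3 then (1 : L) else 0) v :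
        Set ((UnitaryGroup.cmDatum L 3 (Matrix.of fun i j : Fin 3 => if i.val + j.val + 1 = 3 then (1 : L) else 0)).Local v)).indicator fun _ => (1 : ℂ))
      (ConjClasses.mk ((UnitaryGroup.cmDatum L 3 (Matrix.of fun i j : Fin 3 => if i.val + j.val + 1 = 3 then (1 : L) else 0)).toLocal v
        ((UnitaryGroup.cmDatum L 3 (Matrix.of fun i j : Fin 3 => if i.val + j.val + 1 = 3 then (1 : L) else 0)).toAdelic γ))) = 1 := by
    intro v hv
    by_contra hnot
    exact hv (hS (Finset.mem_union_right _ (hUfin.mem_toFinset.2 hnot)))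
  refine MatchingAdeleG.isEulerOnClasses_of_factor hKC hreg hγ _ T.eval mq T.loc mqi T.arch S (fun c hc => ?_) (fun v hv => ?_)
    (fun v hv d hd hne => ?_) (fun v _ => ?_) ?_
  · -- (fac) ★ C3 at the class `c`, unit factors off `S ∪ {v | local class of c ≠ [γ_v]}`
    obtain ⟨p, rfl⟩ := hc
    -- `out [p] ` is the adèle of a matching adèle
    let q : MatchingAdeleG L H γ₀ := p.conj (Quotient.out (ConjClasses.mk p.adele)) (isConj_out_conjClasses_mk p.adele)
    have hq : q.adele = Quotient.out (ConjClasses.mk p.adele) := rfl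
    obtain ⟨S₀, hS₀⟩ := hnorm q
    have hev := MatchingAdeleG.eventually_map_toLocal_eq_mk hKC hreg hγ (MatchingAdeleG.mk_adele_mem_classes p)
    have hevfin := Filter.eventually_cofinite.1 hev
    refine ⟨S ∪ hevfin.toFinset, fun v hv => ?_, ?_⟩
    · -- unit factor off `S ∪ S_ev(c)`
      have hvS : v ∉ S := fun h => hv (Finset.mem_union_left _ h)
      have hvE : ConjClasses.map ((UnitaryGroup.cmDatum L 3
          (Matrix.of fun i j : Fin 3 => if i.val + j.val + 1 = 3 then (1 : L) else 0)).toLocal v) (ConjClasses.mk p.adele) =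
          ConjClasses.mk ((UnitaryGroup.cmDatum L 3 (Matrix.of fun i j : Fin 3 => if i.val + j.val + 1 = 3 then (1 : L) else 0)).toLocal v
            ((UnitaryGroup.cmDatum L 3 (Matrix.of fun i j : Fin 3 => if i.val + j.val + 1 = 3 then (1 : L) else 0)).toAdelic γ)) := by
        by_contra hnot
        exact hv (Finset.mem_union_right _ (hevfin.mem_toFinset.2 hnot))
      rw [← conjClasses_map_eq_mk_out ((UnitaryGroup.cmDatum L 3
          (Matrix.of fun i j : Fin 3 => if i.val + j.val + 1 = 3 then (1 : L) else 0)).toLocal v) (ConjClasses.mk p.adele),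
        hvE, (hT.isUnramified).loc_eq (hS_T v hvS)]
      exact hS_U v hvS
    · rw [hq] at hS₀
      refine UnitaryGroup.classOrbitalIntegral_ofLocalAdelic_eval_eq_mul_prod L 3 _ mq mqi (ConjClasses.mk p.adele) hS₀
        (fun v => hadmAt v _ (hregcorr v _ (by rw [← hq]; exact q.corresponds_toLocal v)))
        (hadmA _ (isRegularElt_of_isConj
          ((UnitaryGroup.arch (↥(maximalRealSubfield L)) L (IsCMField.complexConj L) 3
            (Matrix.of fun i j : Fin 3 => if i.val + j.val + 1 = 3 then (1 : L) else 0)).subtype.map_isConj (isConj_out_conjClasses_mk _))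
          (isRegularElt_of_isConj ((corresponds_cmRationalToArch hγ).isStablyConj_right (by rw [← hq]; exact q.corresponds_arch))
            (hγreg.map (mixedEmbedding L)))))
        T (S ∪ hevfin.toFinset) hT.isUnramified (hFi _ (MatchingAdeleG.mk_adele_mem_classes p)) (fun v hv => ?_)
      -- the same unit-factor statement, read with `out [p]`
      have hvS : v ∉ S := fun h => hv (Finset.mem_union_left _ h)
      have hvE : ConjClasses.map ((UnitaryGroup.cmDatum L 3
          (Matrix.of fun i j : Fin 3 => if i.val + j.val + 1 = 3 then (1 : L) else 0)).toLocal v) (ConjClasses.mk p.adele) =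
          ConjClasses.mk ((UnitaryGroup.cmDatum L 3 (Matrix.of fun i j : Fin 3 => if i.val + j.val + 1 = 3 then (1 : L) else 0)).toLocal v
            ((UnitaryGroup.cmDatum L 3 (Matrix.of fun i j : Fin 3 => if i.val + j.val + 1 = 3 then (1 : L) else 0)).toAdelic γ)) := by
        by_contra hnot
        exact hv (Finset.mem_union_right _ (hevfin.mem_toFinset.2 hnot))
      rw [← conjClasses_map_eq_mk_out ((UnitaryGroup.cmDatum L 3
          (Matrix.of fun i j : Fin 3 => if i.val + j.val + 1 = 3 then (1 : L) else 0)).toLocal v) (ConjClasses.mk p.adele),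
        hvE, (hT.isUnramified).loc_eq (hS_T v hvS)]
      exact hS_U v hvS
  · -- (h1) the base class has unit factor off `S`
    rw [(hT.isUnramified).loc_eq (hS_T v hv)]
    exact hS_U v hv
  · -- (h0) off `S` the other classes of the local stable class have factor `0`
    rw [(hT.isUnramified).loc_eq (hS_T v hv)]
    exact classOrbitalIntegral_indicator_eq_zero_of_corresponds_of_ne v (hS_K v hv) (mq v) d hd hne
  · -- (hfin)
    exact finite_support_classOrbitalIntegral_inter_corresponds_local hreg hγ v (mq v)
      (UnitaryGroup.PureTensor.hasCompactSupport_loc hT.isUnramified hT.isFinSmooth v)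
  · -- (hfinₐ)
    exact finite_support_classOrbitalIntegral_inter_corresponds_arch hreg hγ mqi hT.isArchTest.hasCompactSupport_arch

end Discharge

end Literature.NumberTheory.Rogawski1990

end
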